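import Summits.ResolutionOfSingularities.ResolutionOfSingularities.Theorems.EquisingularLiftEquisingularLiftReducedStrictTransformBlowup
import Summits.ResolutionOfSingularities.ResolutionOfSingularities.Theorems.EquisingularLiftEquisingularLiftSectionComapPoint
import Summits.ResolutionOfSingularities.ResolutionOfSingularities.Theorems.EquisingularLiftEquisingularLiftSectionKer
import Literature.AlgebraicGeometry.Resolution.BlowupsEquivariant
import Literature.AlgebraicGeometry.Resolution.BlowupsLocal
import Literature.AlgebraicGeometry.Resolution.IdealSheafDescent
import HarnessLib

/-!
# [OURS · L1 W4.5(b) · EL♮ T-ISO-0] POINT-STEP TRANSPORT: a downstairs point blow-up and an upstairs Hensel-SECTION blow-up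
# induce ISOMORPHIC reduced strict transforms (brick 1 of res-L1-w45b-lead-2's target T-ISO-0 «point-only downstairs embedded
# resolutions lift to horizontal E1 section chains», `L/res-L1-w45b-lead-2/TARGET-T-ISO-0.lean` d0ee84fae5c3adea)

Crux `EquisingularLiftNat` = stmt-ResolutionOfSingularities-20038 (route EquisingularLift), line `sections`; helper file
`--supports … --as helper` by res-D-pv-029 (T-ISO-0 first call, res-plan-2 D→L MAP v1.14a). HONEST FRAMING: OURS (cell res-hironaka,
slot W4.5(b)); NOT a statement of any manuscript; scheme-theoretic plumbing only. AI-written, weaker than expert review. No `sorry`;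
standard axioms.

THE DEVICE. T-ISO-0's hypothesis is a DOWNSTAIRS chain of blow-ups `υ : F₂ → F₁` of `k`-ambients at non-regular CLOSED points `x` of
the reduced strict transform `Γ₁ = V(T₁)_red`, with `T₂ = closure υ⁻¹(T₁ ∖ {x})`; the section engine of `stub_elnat_le_two` blows the
`O`-ambient `X'` up along a Hensel SECTION `s` through the corresponding point of the upstairs reduced strict transform `Γ' = V(S')_red`.
The two new reduced strict transforms are BOTH blow-ups of the (isomorphic) old ones at the (corresponding) reduced closed point:
downstairs by the tree's strict-transform theorem (Stacks 080E) and `comap_vanishingIdeal_image_of_isClosedImmersion`, upstairs by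
the same theorem and `ker_section_comap_eq_vanishingIdeal` (the section meets the special fibre transversally — the argument of
`curveBlowup_of_isBlowup_section`, minus every curve hypothesis). By uniqueness of blow-ups they are isomorphic. So the induction of
T-ISO-0 only has to carry an ISOMORPHISM OF REDUCED STRICT TRANSFORMS, never an identification of ambient special fibres.

* `isBlowup_comp_iso_vanishingIdeal_singleton`, `exists_iso_of_isBlowup_vanishingIdeal_singleton` — transport / uniqueness of point
  blow-ups along an isomorphism of the base;
* `exists_isBlowup_reducedStrictTransform_point` — DOWNSTAIRS: `V(closure υ⁻¹(T ∖ {x}))_red → V(T)_red` is a blow-up at the reduced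
  point `x` (any locally Noetherian `F₁`);
* `exists_isBlowup_reducedStrictTransform_section` — UPSTAIRS: `V(closure τ⁻¹(S' ∖ s(Spec O)))_red → V(S')_red` is a blow-up at the
  reduced point `z₁ = s(𝔪)` (any dimension);
* `nonempty_iso_reducedStrictTransform_step` — the two new reduced strict transforms are isomorphic whenever the old ones are, by an
  isomorphism matching `x` with `z₁`.

References: The Stacks Project, Tag 080E; Görtz–Wedhorn I, Prop. 13.91/13.96; Liu 2002 §8.1 (blow-ups along sections).
-/

set_option linter.dupNamespace false -- mandated namespace `Summit.<Summit>.<Problem>` of this single-conjunct summit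
set_option linter.overlappingInstances false -- signatures carry `[IsDomain O] [IsDiscreteValuationRing O]`

noncomputable section

open CategoryTheory CategoryTheory.Limits AlgebraicGeometry TopologicalSpace Topology
open Literature.AlgebraicGeometry.Resolution
open AlgebraicGeometry.Scheme.IdealSheafData
open Summit.ResolutionOfSingularities.ResolutionOfSingularities.Cruxes.EquisingularLift.StrataSplit

namespace Summit.ResolutionOfSingularities.ResolutionOfSingularities.Cruxes.EquisingularLiftNat.Sections

universe u

/-! ## Point blow-ups along an isomorphism of the base -/

/-- **Transport of a point blow-up along an isomorphism of the base**: if `ρ : Γ₂ → Γ₁` is a blow-up of `Γ₁` at the reduced closed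
point `x` and `e : Γ₁ ≅ Γ'`, then `ρ ≫ e` is a blow-up of `Γ'` at the reduced closed point `e x`. [folklore] -/
theorem isBlowup_comp_iso_vanishingIdeal_singleton {Γ₂ Γ₁ Γ' : Scheme.{u}} {ρ : Γ₂ ⟶ Γ₁} {x : Γ₁}
    (hx : IsClosed ({x} : Set Γ₁)) (hρ : IsBlowup ρ (vanishingIdeal ⟨{x}, hx⟩)) (e : Γ₁ ≅ Γ')
    (hx' : IsClosed ({e.hom x} : Set Γ')) : IsBlowup (ρ ≫ e.hom) (vanishingIdeal ⟨{e.hom x}, hx'⟩) := by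
  have h := hρ.comp_iso e
  have hc : (vanishingIdeal (⟨{x}, hx⟩ : Closeds Γ₁)).comap e.inv = vanishingIdeal ⟨{e.hom x}, hx'⟩ := by
    rw [show e.inv = e.symm.hom from rfl, vanishingIdeal_comap_hom]
    congr 1
    apply Closeds.ext
    ext y
    change e.symm.hom y ∈ ({x} : Set Γ₁) ↔ y ∈ ({e.hom x} : Set Γ')
    rw [Set.mem_singleton_iff, Set.mem_singleton_iff]
    constructor
    · intro hy
      have h1 : e.hom (e.symm.hom y) = y := by
        rw [← Scheme.Hom.comp_apply]; simp
      rw [← h1, hy]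
    · rintro rfl
      rw [← Scheme.Hom.comp_apply]; simp
  rwa [hc] at h

/-- **Two point blow-ups over isomorphic bases are isomorphic**: `ρ : Γ₂ → Γ₁` a blow-up at `x`, `e : Γ₁ ≅ Γ'`, `ρ' : Γ'' → Γ'` a
blow-up at `e x` ⇒ `Γ₂ ≅ Γ''` over `e`. [cite: GortzWedhorn2020, (13.19) p. 413 (uniqueness of blow-ups)] -/
theorem exists_iso_of_isBlowup_vanishingIdeal_singleton {Γ₂ Γ₁ Γ' Γ'' : Scheme.{u}} {ρ : Γ₂ ⟶ Γ₁} {x : Γ₁}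
    (hx : IsClosed ({x} : Set Γ₁)) (hρ : IsBlowup ρ (vanishingIdeal ⟨{x}, hx⟩)) (e : Γ₁ ≅ Γ')
    (hx' : IsClosed ({e.hom x} : Set Γ')) {ρ' : Γ'' ⟶ Γ'} (hρ' : IsBlowup ρ' (vanishingIdeal ⟨{e.hom x}, hx'⟩)) :
    ∃ e₂ : Γ₂ ≅ Γ'', e₂.hom ≫ ρ' = ρ ≫ e.hom :=
  let ⟨e₂, h₁, _⟩ := (isBlowup_comp_iso_vanishingIdeal_singleton hx hρ e hx').unique hρ'
  ⟨e₂, h₁⟩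

/-! ## DOWNSTAIRS: the reduced strict transform under a point blow-up of the ambient -/

/-- **Downstairs step.** Let `F₁` be locally Noetherian, `T ⊆ F₁` closed irreducible, `x` a point of the reduced subscheme
`Γ₁ = V(T)_red` whose image `ι x` is a closed point of `F₁`, `T ≠ {ι x}` (e.g. `x` non-regular), and `υ : F₂ → F₁` a blow-up along the
reduced point `ι x` with `F₂` locally Noetherian. Then the reduced strict transform `V(closure υ⁻¹(T ∖ {ι x}))_red` maps to `Γ₁` by a
proper morphism over `υ` which is a BLOW-UP of `Γ₁` at the reduced point `x`. [cite: StacksProject, Tag 080E (1)] -/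
theorem exists_isBlowup_reducedStrictTransform_point (F₁ F₂ : AlgebraicGeometry.Scheme.{0}) [IsLocallyNoetherian F₁]
    [IsLocallyNoetherian F₂] (T : Set F₁) (hT : IsClosed T) (hTirr : IsIrreducible T)
    (x : ↥(vanishingIdeal (⟨T, hT⟩ : Closeds F₁)).subscheme)
    (hx : IsClosed ({((vanishingIdeal (⟨T, hT⟩ : Closeds F₁)).subschemeι x : F₁)} : Set F₁))
    (hne : ¬ T ⊆ {((vanishingIdeal (⟨T, hT⟩ : Closeds F₁)).subschemeι x : F₁)})
    (υ : F₂ ⟶ F₁) (hυ : IsBlowup υ (vanishingIdeal ⟨{((vanishingIdeal (⟨T, hT⟩ : Closeds F₁)).subschemeι x : F₁)}, hx⟩)) :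
    ∃ (hcl : IsClosed ({x} : Set ↥(vanishingIdeal (⟨T, hT⟩ : Closeds F₁)).subscheme))
      (ρ : (vanishingIdeal (⟨closure (υ ⁻¹' (T \ ((vanishingIdeal (⟨{((vanishingIdeal (⟨T, hT⟩ : Closeds F₁)).subschemeι x : F₁)},
          hx⟩ : Closeds F₁)).support : Set F₁))), isClosed_closure⟩ : Closeds F₂)).subscheme ⟶
        (vanishingIdeal (⟨T, hT⟩ : Closeds F₁)).subscheme),
      ρ ≫ (vanishingIdeal (⟨T, hT⟩ : Closeds F₁)).subschemeι =
        (vanishingIdeal (⟨closure (υ ⁻¹' (T \ ((vanishingIdeal (⟨{((vanishingIdeal (⟨T, hT⟩ : Closeds F₁)).subschemeι x : F₁)},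
          hx⟩ : Closeds F₁)).support : Set F₁))), isClosed_closure⟩ : Closeds F₂)).subschemeι ≫ υ ∧
      IsProper ρ ∧ IsBlowup ρ (vanishingIdeal ⟨{x}, hcl⟩) := by
  haveI : IsProper υ := hυ.isProper
  set ι₁ := (vanishingIdeal (⟨T, hT⟩ : Closeds F₁)).subschemeι with hι₁
  have hsupp : ((vanishingIdeal (⟨{(ι₁ x : F₁)}, hx⟩ : Closeds F₁)).support : Set F₁) = {(ι₁ x : F₁)} := by
    rw [coe_support_vanishingIdeal]; rfl
  have hne' : ¬ T ⊆ ((vanishingIdeal (⟨{(ι₁ x : F₁)}, hx⟩ : Closeds F₁)).support : Set F₁) := by rwa [hsupp]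
  obtain ⟨ρ, hρι, hρp, hρb⟩ := exists_isBlowup_reducedStrictTransform F₁ F₂ υ _ hυ T hT hTirr hne'
  -- the closed point `x` of `Γ₁`
  have hcl : IsClosed ({x} : Set ↥(vanishingIdeal (⟨T, hT⟩ : Closeds F₁)).subscheme) := by
    have e : ({x} : Set _) = ι₁ ⁻¹' {(ι₁ x : F₁)} := by
      ext z
      simp only [Set.mem_singleton_iff, Set.mem_preimage]
      exact ⟨fun h => by rw [h], fun h => ι₁.isClosedEmbedding.injective h⟩
    rw [e]
    exact hx.preimage ι₁.continuous
  -- the centre of `ρ` is the reduced point `x`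
  have himg : (⟨ι₁ '' (({x} : Set _) : Set _), ι₁.isClosedEmbedding.isClosedMap _ hcl⟩ : Closeds F₁) =
      ⟨{(ι₁ x : F₁)}, hx⟩ := Closeds.ext (Set.image_singleton)
  have hcomap : (vanishingIdeal (⟨{(ι₁ x : F₁)}, hx⟩ : Closeds F₁)).comap ι₁ = vanishingIdeal ⟨{x}, hcl⟩ := by
    rw [← himg]
    exact comap_vanishingIdeal_image_of_isClosedImmersion ι₁ ⟨{x}, hcl⟩
  refine ⟨hcl, ρ, hρι, hρp, ?_⟩
  rwa [hcomap] at hρb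

/-! ## UPSTAIRS: the reduced strict transform under the blow-up along a Hensel section -/

/-- **Upstairs step** (the blow-up half of `curveBlowup_of_isBlowup_section`, any dimension). Let `O` be a discrete valuation
ring, `r' : X' → Spec O` proper with `X'` integral, `s` a section of `r'`, `τ : X'' → X'` a blow-up along `ker s` with `X''`
locally Noetherian, `S' ⊆ X'` closed irreducible inside the special fibre with `S' ⊄ s(Spec O)`, and `z₁` the point of
`Γ' = V(S')_red` over `s(𝔪)`. Then `V(closure τ⁻¹(S' ∖ s(Spec O)))_red → Γ'` is a proper morphism over `τ` which is a BLOW-UP of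
`Γ'` at the reduced closed point `z₁`. [cite: StacksProject, Tag 080E (1); Liu2002, §8.1] -/
theorem exists_isBlowup_reducedStrictTransform_section (O : Type) [CommRing O] [IsDomain O] [IsDiscreteValuationRing O]
    (X' X'' : AlgebraicGeometry.Scheme.{0}) [IsIntegral X'] [IsLocallyNoetherian X''] (r' : X' ⟶ Spec (.of O)) [IsProper r']
    (s : Spec (.of O) ⟶ X') (hs : s ≫ r' = 𝟙 _) (τ : X'' ⟶ X') (hτ : IsBlowup τ s.ker)
    (S' : Set X') (hS' : IsClosed S') (hirr : IsIrreducible S') (hSfib : S' ⊆ r' ⁻¹' {IsLocalRing.closedPoint O})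
    (hSC : ¬ S' ⊆ (s.ker.support : Set X'))
    (z₁ : ↥(vanishingIdeal (⟨S', hS'⟩ : Closeds X')).subscheme)
    (hz₁ : ((vanishingIdeal (⟨S', hS'⟩ : Closeds X')).subschemeι z₁ : X') = s (IsLocalRing.closedPoint O)) :
    ∃ (hcl : IsClosed ({z₁} : Set ↥(vanishingIdeal (⟨S', hS'⟩ : Closeds X')).subscheme))
      (ρ : (vanishingIdeal (⟨closure (τ ⁻¹' (S' \ (s.ker.support : Set X'))), isClosed_closure⟩ :
        Closeds X'')).subscheme ⟶ (vanishingIdeal (⟨S', hS'⟩ : Closeds X')).subscheme),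
      ρ ≫ (vanishingIdeal (⟨S', hS'⟩ : Closeds X')).subschemeι =
        (vanishingIdeal (⟨closure (τ ⁻¹' (S' \ (s.ker.support : Set X'))), isClosed_closure⟩ :
          Closeds X'')).subschemeι ≫ τ ∧
      IsProper ρ ∧ IsBlowup ρ (vanishingIdeal ⟨{z₁}, hcl⟩) := by
  haveI : IsNoetherianRing (CommRingCat.of O) := inferInstanceAs (IsNoetherianRing O)
  haveI : IsLocallyNoetherian X' := LocallyOfFiniteType.isLocallyNoetherian r'
  haveI : IsProper τ := hτ.isProper
  haveI : IsIntegral (vanishingIdeal (⟨S', hS'⟩ : Closeds X')).subscheme :=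
    ComponentGluing.isIntegral_subscheme_vanishingIdeal ⟨S', hS'⟩ hirr
  set ι₁ := (vanishingIdeal (⟨S', hS'⟩ : Closeds X')).subschemeι with hι₁
  obtain ⟨ρ, hρι, hρp, hρb⟩ := exists_isBlowup_reducedStrictTransform X' X'' τ s.ker hτ S' hS' hirr hSC
  have hrange₁ : Set.range ⇑(ι₁ ≫ r') ⊆ {IsLocalRing.closedPoint O} := by
    rintro _ ⟨z, rfl⟩
    rw [Scheme.Hom.comp_apply]
    refine hSfib ?_
    have hz : ι₁ z ∈ Set.range ι₁ := ⟨z, rfl⟩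
    rw [range_subschemeι, coe_support_vanishingIdeal] at hz
    exact hz
  have hclpt : IsClosed ({s (IsLocalRing.closedPoint O)} : Set X') :=
    (section_isClosedImmersion_and_isRegular_ker O X' r' s hs).2.2.1
  have hcl : IsClosed ({z₁} : Set ↥(vanishingIdeal (⟨S', hS'⟩ : Closeds X')).subscheme) := by
    have e : ({z₁} : Set _) = ι₁ ⁻¹' {s (IsLocalRing.closedPoint O)} := by
      ext z
      simp only [Set.mem_singleton_iff, Set.mem_preimage]
      exact ⟨fun h => by rw [h]; exact hz₁, fun h => ι₁.isClosedEmbedding.injective (h.trans hz₁.symm)⟩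
    rw [e]
    exact hclpt.preimage ι₁.continuous
  have hcomap : s.ker.comap ι₁ = vanishingIdeal ⟨{z₁}, hcl⟩ :=
    ker_section_comap_eq_vanishingIdeal O X' _ r' s hs ι₁ hrange₁ z₁ hz₁ hcl
  refine ⟨hcl, ρ, hρι, hρp, ?_⟩
  rwa [hcomap] at hρb

/-! ## The two new reduced strict transforms are isomorphic -/

/-- **POINT-STEP TRANSPORT.** In the situation of the two previous theorems, if the old reduced strict transforms are isomorphic by
`e : V(T)_red ≅ V(S')_red` with `e x = z₁`, then so are the new ones:
`V(closure υ⁻¹(T ∖ {ι x}))_red ≅ V(closure τ⁻¹(S' ∖ s(Spec O)))_red`. This is the only identification the induction of T-ISO-0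
carries. [cite: GortzWedhorn2020, (13.19) p. 413; StacksProject, Tag 080E] -/
theorem nonempty_iso_reducedStrictTransform_step (O : Type) [CommRing O] [IsDomain O] [IsDiscreteValuationRing O]
    -- downstairs
    (F₁ F₂ : AlgebraicGeometry.Scheme.{0}) [IsLocallyNoetherian F₁] [IsLocallyNoetherian F₂] (T : Set F₁) (hT : IsClosed T)
    (hTirr : IsIrreducible T) (x : ↥(vanishingIdeal (⟨T, hT⟩ : Closeds F₁)).subscheme)
    (hx : IsClosed ({((vanishingIdeal (⟨T, hT⟩ : Closeds F₁)).subschemeι x : F₁)} : Set F₁))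
    (hne : ¬ T ⊆ {((vanishingIdeal (⟨T, hT⟩ : Closeds F₁)).subschemeι x : F₁)})
    (υ : F₂ ⟶ F₁) (hυ : IsBlowup υ (vanishingIdeal ⟨{((vanishingIdeal (⟨T, hT⟩ : Closeds F₁)).subschemeι x : F₁)}, hx⟩))
    -- upstairs
    (X' X'' : AlgebraicGeometry.Scheme.{0}) [IsIntegral X'] [IsLocallyNoetherian X''] (r' : X' ⟶ Spec (.of O)) [IsProper r']
    (s : Spec (.of O) ⟶ X') (hs : s ≫ r' = 𝟙 _) (τ : X'' ⟶ X') (hτ : IsBlowup τ s.ker)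
    (S' : Set X') (hS' : IsClosed S') (hirr : IsIrreducible S') (hSfib : S' ⊆ r' ⁻¹' {IsLocalRing.closedPoint O})
    (hSC : ¬ S' ⊆ (s.ker.support : Set X'))
    -- the identification
    (e : (vanishingIdeal (⟨T, hT⟩ : Closeds F₁)).subscheme ≅ (vanishingIdeal (⟨S', hS'⟩ : Closeds X')).subscheme)
    (hex : ((vanishingIdeal (⟨S', hS'⟩ : Closeds X')).subschemeι (e.hom x) : X') = s (IsLocalRing.closedPoint O)) :
    Nonempty ((vanishingIdeal (⟨closure (υ ⁻¹' (T \ ((vanishingIdeal (⟨{((vanishingIdeal (⟨T, hT⟩ : Closeds F₁)).subschemeι x : F₁)},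
          hx⟩ : Closeds F₁)).support : Set F₁))), isClosed_closure⟩ : Closeds F₂)).subscheme ≅
      (vanishingIdeal (⟨closure (τ ⁻¹' (S' \ (s.ker.support : Set X'))), isClosed_closure⟩ :
        Closeds X'')).subscheme) := by
  obtain ⟨hcl, ρ₂, -, -, hρ₂⟩ := exists_isBlowup_reducedStrictTransform_point F₁ F₂ T hT hTirr x hx hne υ hυ
  obtain ⟨hcl', ρ', -, -, hρ'⟩ :=
    exists_isBlowup_reducedStrictTransform_section O X' X'' r' s hs τ hτ S' hS' hirr hSfib hSC (e.hom x) hex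
  obtain ⟨e₂, -⟩ := exists_iso_of_isBlowup_vanishingIdeal_singleton hcl hρ₂ e hcl' hρ'
  exact ⟨e₂⟩

end Summit.ResolutionOfSingularities.ResolutionOfSingularities.Cruxes.EquisingularLiftNat.Sections

end
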